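import Summits.Ventures.Crystal3D.Theorems.StickyWulffConstantCoaxialWallLawTwinTwinDichotomy
import HarnessLib

/-!
# Sticky Wulff constant — coaxial wall law, T5b: adjacent twin readers with the SAME axis share the lattice pair

Support file for `stmt-Ventures-19481` (lane F 'Certificates' v7, T5b reader-lattice graph, input (R1) of cf-p1 (ccxxvi)).
Complement of the Σ9 branch of `TailResidue.TwinTwinDichotomy`: if two ADJACENT twin readers `q₁`, `q₂` of a `1`-separated
configuration have the same twin axis (`m₂ = ±m₁`), then the second reader's OWN lattice is one of the first reader's two
lattices — its own lattice `G₁·Λ` or its mirror lattice `(G₁ ∘ R_{m₁})·Λ` — and so is its mirror lattice; together with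
`mem_twinDozen_of_contact_of_isTwinReading` (the bond `q₂ − q₁` is a vector of `q₁`'s twin dozen) this is the
«same axis ⇒ same coaxial bicrystal» half of the reader-lattice graph.

* `reflection_eq_of_sameAxis` : `R_{−m} = R_{m}` (unit `m`); `image_reflection_image`;
* `movedFcc_sameAxis` : the lattice statement above (both lattices of reader 2 ∈ {own, mirror} of reader 1).
-/

noncomputable section

namespace Summit.Ventures.Crystal3D.Theorems

namespace EndRowFloor

open Summit.Ventures.Crystal3D Finset NearIdentity TailResidue
open Literature.MathematicalPhysics.StatisticalMechanics (fccStacking)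
open scoped InnerProductSpace

variable {X : Finset (EuclideanSpace ℝ (Fin 3))}

/-- Same axis (unit normal): the two mirrors coincide. -/
theorem reflection_eq_of_sameAxis {m₁ m₂ : EuclideanSpace ℝ (Fin 3)} (hm : ‖m₁‖ = 1) (h : m₂ = m₁ ∨ m₂ = -m₁) :
    (ℝ ∙ m₂)ᗮ.reflection = (ℝ ∙ m₁)ᗮ.reflection := by
  rcases h with rfl | rfl
  · rfl
  · refine LinearIsometryEquiv.ext fun x => ?_
    rw [reflection_unit_apply hm, reflection_unit_apply (by rw [norm_neg, hm]), inner_neg_right, smul_neg, mul_neg,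
      neg_smul, neg_neg]

/-- A reflection applied twice to a set gives the set back. -/
theorem image_reflection_image (K : Submodule ℝ (EuclideanSpace ℝ (Fin 3))) [K.HasOrthogonalProjection]
    (S : Set (EuclideanSpace ℝ (Fin 3))) : K.reflection '' (K.reflection '' S) = S := by
  rw [← Set.image_comp]
  convert Set.image_id S with x
  simp [Submodule.reflection_reflection]

/-- **SAME AXIS ⇒ SAME LATTICE PAIR.**  For adjacent twin readers with `m₂ = ±m₁` in a `1`-separated `X`, BOTH lattices
of the second reader (own `G₂·Λ` and mirror `(G₂ ∘ R_{m₂})·Λ`) are among the two lattices of the first reader. -/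
theorem movedFcc_sameAxis (hX : ∀ p ∈ X, ∀ q ∈ X, p ≠ q → 1 ≤ dist p q)
    {G₁ G₂ : EuclideanSpace ℝ (Fin 3) ≃ₗᵢ[ℝ] EuclideanSpace ℝ (Fin 3)} {m₁ m₂ q₁ q₂ : EuclideanSpace ℝ (Fin 3)}
    (hq₁ : q₁ ∈ X) (hq₂ : q₂ ∈ X) (h₁ : IsTwinReading X G₁ m₁ q₁) (h₂ : IsTwinReading X G₂ m₂ q₂) (hd : dist q₁ q₂ = 1)
    (hax : m₂ = m₁ ∨ m₂ = -m₁) :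
    (G₂ '' fccStacking 1 (Real.sqrt (2 / 3)) = G₁ '' fccStacking 1 (Real.sqrt (2 / 3)) ∨
      G₂ '' fccStacking 1 (Real.sqrt (2 / 3)) = (G₁.trans (ℝ ∙ m₁)ᗮ.reflection) '' fccStacking 1 (Real.sqrt (2 / 3))) ∧
    ((G₂.trans (ℝ ∙ m₂)ᗮ.reflection) '' fccStacking 1 (Real.sqrt (2 / 3)) = G₁ '' fccStacking 1 (Real.sqrt (2 / 3)) ∨
      (G₂.trans (ℝ ∙ m₂)ᗮ.reflection) '' fccStacking 1 (Real.sqrt (2 / 3)) =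
        (G₁.trans (ℝ ∙ m₁)ᗮ.reflection) '' fccStacking 1 (Real.sqrt (2 / 3))) := by
  have hR₂ : (ℝ ∙ m₂)ᗮ.reflection = (ℝ ∙ m₁)ᗮ.reflection := reflection_eq_of_sameAxis h₁.1.1 hax
  have RR := image_reflection_image (ℝ ∙ m₁)ᗮ
  obtain ⟨A, B, hA, hB, hAB⟩ := movedFcc_eq_of_isTwinReading_adjacent hX hq₁ hq₂ h₁ h₂ hd
  rw [hR₂] at hB ⊢
  simp only [image_trans_eq] at hAB ⊢
  rcases hA with rfl | rfl <;> rcases hB with rfl | rfl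
  · -- own₁ = own₂
    refine ⟨Or.inl hAB.symm, Or.inr ?_⟩
    rw [hAB]
  · -- own₁ = mirror₂
    rw [image_trans_eq] at hAB
    refine ⟨Or.inr ?_, Or.inl hAB.symm⟩
    have := congrArg (fun S => ((ℝ ∙ m₁)ᗮ).reflection '' S) hAB
    simp only [RR] at this
    exact this.symm
  · -- mirror₁ = own₂
    rw [image_trans_eq] at hAB
    refine ⟨Or.inr hAB.symm, Or.inl ?_⟩
    have := congrArg (fun S => ((ℝ ∙ m₁)ᗮ).reflection '' S) hAB
    simp only [RR] at this
    exact this.symm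
  · -- mirror₁ = mirror₂
    rw [image_trans_eq, image_trans_eq] at hAB
    refine ⟨Or.inl ?_, Or.inr hAB.symm⟩
    have := congrArg (fun S => ((ℝ ∙ m₁)ᗮ).reflection '' S) hAB
    simp only [RR] at this
    exact this.symm

end EndRowFloor

end Summit.Ventures.Crystal3D.Theorems

end
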